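import Literature.Computability.AlgebraicComplexity.AndrewsForbes2022Prop35AllFields
import Literature.Computability.AlgebraicComplexity.AndrewsForbes2022Thm73Proofs
import Literature.Computability.AlgebraicComplexity.AndrewsForbes2022Lemma66Proofs
import Literature.Computability.AlgebraicComplexity.ABV17SingularLocusBound

/-!
# Andrews–Forbes 2022, Lemma 6.6 for every field — the discharge of `AndrewsForbes2022_lemma_6_6`

`AndrewsForbes2022Lemma66Proofs.lean` proves the engine of AF22 Lemma 6.6 (p0033:L33) for every
field modulo the conclusion of Cor. 3.10 for the polynomial at hand, and Lemma 6.6 in characteristic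
`0`.  The printed hypothesis is `char F = 0 ∨ char F > deg f`; in characteristic `p > deg f` the
printed proof (p0033:L69–L72) uses the third bullet of Cor. 3.10 / Thm. 3.8 and observes that the
`p`-th power exponent `k` vanishes: "`deg(f) ≥ deg(IMM_{w,d}^{p^k}) = d p^k` … By assumption, we have
`p > deg(f)`, so `k = 0`."  This file formalizes that step at its source and closes the named fact:

* `Theorem38.isHomogeneous_minor`, `isHomogeneous_leadingMinor`, `isHomogeneous_kBideterminant`,
  `totalDegree_kBideterminant` — minors are forms of degree `r`, `(K_σ | K_σ)` is a form of degree
  `|σ|` (with the tree's `kBideterminant_ne_zero`); `le_totalDegree_of_mem_detIdeal` — a nonzero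
  element of `I^det_{n,m,r}` has degree `≥ r`; `sum_le_totalDegree_of_prop35` — in Prop. 3.5's
  identity `f(c·X) = ε^q α (K_σ | K_σ) + O(ε^{q+1})`, every monomial of `(K_σ | K_σ)` occurs in
  `f(c·X)`, so `|σ| ≤ deg f`.
* `AndrewsForbes2022_thm_3_8_posChar_deg_lt` — **Thm. 3.8, third bullet, with `k = 0` when
  `char F = p > deg f`**: in the printed proof (p0024:L40–L45) `p^k` is the `p`-part of
  `t = #{i : σ_i ≥ r}`, and `t ≤ t·r ≤ |σ| ≤ deg f < p`, so `k = 0`; the proof is the skeleton of the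
  tree's `AndrewsForbes2022_thm_3_8_posChar_at` (`AndrewsForbes2022PosCharReductions.lean`) verbatim
  with `t = p^0 · t`.
* `AndrewsForbes2022_cor_3_10_posChar_deg_lt` — Cor. 3.10 accordingly (`IMM_{w,d} + O(ε)` itself).
* `AndrewsForbes2022_lemma_6_6_holds : AndrewsForbes2022_lemma_6_6` — **the named fact, PROVED**
  (`c = log 56`; char `0` through `AndrewsForbes2022_cor_3_10_holds`, char `p > deg f ≥ r` through
  the above).

Theorem-only; no new definitions, no new named facts (D-0026); net debt `−1`.
Honest framing: an explicit constant-depth border lower bound as printed; VP ≠ VNP is NOT touched.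

## References
* [AndrewsForbes2022] R. Andrews, M. A. Forbes, *Ideals, determinants, and straightening: proving and
  using lower bounds for polynomial ideals*, STOC 2022, arXiv:2112.00792 — Prop. 3.5 (p0021:L41),
  Thm. 3.8 and its proof (p0023:L48–p0024:L55), Cor. 3.10 (p0024:L76), Lemma 6.6 and its proof
  (p0033:L33–L80).
-/

noncomputable section

open MvPolynomial
open scoped Polynomial RatFunc LaurentSeries Matrix

namespace Literature.Computability.AlgebraicComplexity

namespace Theorem38

universe u

variable {F : Type u} [Field F] {n m : ℕ}

/-- Every `r × r` minor of the generic matrix is homogeneous of degree `r`.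
[cite: AndrewsForbes2022, §2.6 (the ideal `I^det_{n,m,r}` is generated by degree-`r` forms)] -/
theorem isHomogeneous_minor {r : ℕ} (ρ : Fin r → Fin n) (γ : Fin r → Fin m) :
    (((Matrix.mvPolynomialX (Fin n) (Fin m) F).submatrix ρ γ).det).IsHomogeneous r := by
  have := AlperBogartVelasco.isHomogeneous_det_of_linear
    ((Matrix.mvPolynomialX (Fin n) (Fin m) F).submatrix ρ γ)
    fun i j => by
      rw [Matrix.submatrix_apply, Matrix.mvPolynomialX_apply]; exact isHomogeneous_X _ _
  simpa using this

/-- The leading principal `s × s` minor is homogeneous of degree `s` (for `s ≤ min(n,m)`).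
[cite: AndrewsForbes2022, Def. 2.23 and §3.1] -/
theorem isHomogeneous_leadingMinor {s : ℕ} (hn : s ≤ n) (hm : s ≤ m) :
    (leadingMinor F n m s).IsHomogeneous s := by
  rw [leadingMinor_of_le hn hm]; exact isHomogeneous_minor _ _

/-- The leading principal minor is homogeneous of degree `s` in all cases (the junk value `0` for
`s > min(n,m)` is homogeneous of every degree). [cite: AndrewsForbes2022, Def. 2.23 and §3.1] -/
theorem isHomogeneous_leadingMinor' (s : ℕ) : (leadingMinor F n m s).IsHomogeneous s := by
  by_cases h : s ≤ n ∧ s ≤ m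
  · exact isHomogeneous_leadingMinor h.1 h.2
  · rw [leadingMinor, dif_neg h]; exact isHomogeneous_zero _ _ _

/-- **`(K_σ | K_σ)` is homogeneous of degree `|σ| = Σ σᵢ`.** [cite: AndrewsForbes2022, §3.1 and Def. 2.23] -/
theorem isHomogeneous_kBideterminant (σ : Multiset ℕ) :
    (kBideterminant F n m σ).IsHomogeneous σ.sum := by
  induction σ using Multiset.induction_on with
  | empty => simpa using isHomogeneous_one (Fin n × Fin m) F
  | cons s σ ih =>
    rw [kBideterminant_cons, Multiset.sum_cons]
    exact (isHomogeneous_leadingMinor' s).mul ih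

/-- **`deg (K_σ | K_σ) = |σ|`** for a shape with parts in `[1, min(n,m)]`.
[cite: AndrewsForbes2022, §3.1 and Def. 2.23] -/
theorem totalDegree_kBideterminant {σ : Multiset ℕ} (hσ : ∀ p ∈ σ, 0 < p ∧ p ≤ min n m) :
    (kBideterminant F n m σ).totalDegree = σ.sum :=
  (isHomogeneous_kBideterminant σ).totalDegree (kBideterminant_ne_zero hσ)

/-- Every monomial of an element of `I^det_{n,m,r}` has degree `≥ r` (the ideal is generated by
forms of degree `r`). [cite: AndrewsForbes2022, §2.6 (the ideal `I^det_{n,m,r}`)] -/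
theorem le_degree_of_mem_support_of_mem_detIdeal {r : ℕ} {f : MvPolynomial (Fin n × Fin m) F}
    (hf : f ∈ detIdeal F n m r) : ∀ d ∈ f.support, r ≤ d.degree := by
  classical
  unfold detIdeal at hf
  refine Submodule.span_induction (p := fun f _ => ∀ d ∈ f.support, r ≤ d.degree) ?_ ?_ ?_ ?_ hf
  · rintro g ⟨ρ, γ, rfl⟩ d hd
    exact ((isHomogeneous_minor ρ γ).degree_eq_sum_deg_support hd ▸ (Finsupp.degree_apply d).symm ▸
      le_rfl)
  · intro d hd; simp at hd
  · intro x y _ _ hx hy d hd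
    rcases Finset.mem_union.1 (MvPolynomial.support_add hd) with h | h
    · exact hx d h
    · exact hy d h
  · intro a x _ hx d hd
    rw [smul_eq_mul] at hd
    obtain ⟨da, -, dx, hdx, rfl⟩ := Finset.mem_add.1 (MvPolynomial.support_mul a x hd)
    rw [map_add]
    exact (hx dx hdx).trans (Nat.le_add_left _ _)

/-- **A nonzero element of `I^det_{n,m,r}` has degree `≥ r`.**
[cite: AndrewsForbes2022, §2.6 (the ideal `I^det_{n,m,r}`)] -/
theorem le_totalDegree_of_mem_detIdeal {r : ℕ} {f : MvPolynomial (Fin n × Fin m) F}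
    (hf : f ∈ detIdeal F n m r) (hf0 : f ≠ 0) : r ≤ f.totalDegree := by
  obtain ⟨d, hd⟩ := MvPolynomial.exists_coeff_ne_zero hf0
  have hd' : d ∈ f.support := MvPolynomial.mem_support_iff.2 hd
  refine (le_degree_of_mem_support_of_mem_detIdeal hf d hd').trans ?_
  simpa [Finsupp.degree_apply, Finsupp.sum] using MvPolynomial.le_totalDegree hd'

/-- **Degree bookkeeping in Prop. 3.5** (used for the third bullet of Thm. 3.8 with `k = 0`,
p0033:L69–L72): if `f(c·X) = ε^q α (K_σ | K_σ)(X) + O(ε^{q+1})` coefficientwise with `α ≠ 0`, then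
every monomial of `(K_σ | K_σ)` occurs in `f(c·X)`, so `|σ| = deg (K_σ | K_σ) ≤ deg f`.
[cite: AndrewsForbes2022, Prop. 3.5 and Thm. 3.8 (proof)] -/
theorem sum_le_totalDegree_of_prop35 {c : Matrix (Fin n × Fin m) (Fin n × Fin m) (RatFunc F)}
    {q : ℤ} {α : F} (hα : α ≠ 0) {σ : Multiset ℕ} (hσ : ∀ s ∈ σ, 0 < s ∧ s ≤ min n m)
    {f : MvPolynomial (Fin n × Fin m) F}
    (h35 : ∀ e : (Fin n × Fin m) →₀ ℕ,
      IsBigOEps F (q + 1) (MvPolynomial.coeff e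
        (MvPolynomial.aeval
            (fun ij : Fin n × Fin m =>
              ∑ kl : Fin n × Fin m, MvPolynomial.C (c ij kl) * MvPolynomial.X kl) f -
          MvPolynomial.C (RatFunc.X ^ q * algebraMap F (RatFunc F) α) *
            MvPolynomial.map (algebraMap F (RatFunc F)) (kBideterminant F n m σ)))) :
    σ.sum ≤ f.totalDegree := by
  classical
  rw [← totalDegree_kBideterminant (F := F) hσ]
  -- every monomial of `K_σ` occurs in `f(c·X)`
  have hsupp : (kBideterminant F n m σ).support ⊆
      (MvPolynomial.aeval (fun ij : Fin n × Fin m =>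
        ∑ kl : Fin n × Fin m, MvPolynomial.C (c ij kl) * MvPolynomial.X kl) f).support := by
    intro d hd
    rw [MvPolynomial.mem_support_iff] at hd ⊢
    intro h0
    have h := h35 d q (by omega)
    rw [MvPolynomial.coeff_sub, h0, zero_sub, MvPolynomial.coeff_C_mul, MvPolynomial.coeff_map,
      map_neg, map_mul, map_mul, coe_ratFunc_X_zpow, coe_ratFunc_algebraMap,
      coe_ratFunc_algebraMap, HahnSeries.coeff_neg, neg_eq_zero, HahnSeries.C_apply,
      HahnSeries.C_apply, HahnSeries.single_mul_single, HahnSeries.single_mul_single] at h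
    simp only [add_zero, one_mul, HahnSeries.coeff_single_same, mul_eq_zero] at h
    rcases h with h | h
    · exact hα h
    · exact hd h
  refine (Finset.sup_mono hsupp).trans ?_
  change MvPolynomial.totalDegree (MvPolynomial.aeval (fun ij : Fin n × Fin m =>
        ∑ kl : Fin n × Fin m, MvPolynomial.C (c ij kl) * MvPolynomial.X kl) f) ≤ _
  rw [show MvPolynomial.aeval (fun ij : Fin n × Fin m =>
        ∑ kl : Fin n × Fin m, MvPolynomial.C (c ij kl) * MvPolynomial.X kl) f =
      MvPolynomial.bind₁ (fun ij : Fin n × Fin m =>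
        ∑ kl : Fin n × Fin m, MvPolynomial.C (c ij kl) * MvPolynomial.X kl)
        (MvPolynomial.map (algebraMap F (RatFunc F)) f) from by
    rw [MvPolynomial.bind₁, MvPolynomial.aeval_map_algebraMap]]
  exact (totalDegree_bind₁_le_of_le_one _ (fun ij => totalDegree_linear_le _) _).trans
    (totalDegree_map_le' _ _)

end Theorem38

/-! ### Theorem 3.8 / Corollary 3.10 with `k = 0` in characteristic `p > deg f` -/

set_option maxHeartbeats 1600000 in
open Theorem38 in
/-- **Theorem 3.8, third bullet, with `k = 0` when `char F = p > deg f`** (the case Lemma 6.6 uses,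
p0033:L69–L72: "`deg(f) ≥ deg(IMM^{p^k}) = d p^k` … By assumption, we have `p > deg(f)`, so `k = 0`").
The intrinsic reason, formalized here: in the printed proof of Thm. 3.8 (p0024:L40–L45) the exponent is
the `p`-part of `t = #{i : σ_i ≥ r}`, and `t ≤ t·r ≤ |σ| = deg (K_σ | K_σ) ≤ deg f < p`
(`sum_le_totalDegree_of_prop35`: every monomial of `(K_σ | K_σ)` occurs in `f(c·X)` by Prop. 3.5's
identity), so `p ∤ t` and `k = 0`; the rest is the skeleton of `AndrewsForbes2022_thm_3_8_posChar_at`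
verbatim with `t = p^0 · t` (old `ε ↦ ε^{D+1}`, top gate `÷ α t`).  Hypothesis `h35F` = Prop. 3.5's
conclusion over the field at hand (discharged for every field by `AndrewsForbes2022_prop_3_5_of_field`).
No new named fact. [cite: AndrewsForbes2022, Thm. 3.8 (third bullet, proof) and Lemma 6.6 (proof)] -/
theorem AndrewsForbes2022_thm_3_8_posChar_deg_lt (p : ℕ) [Fact p.Prime] (F : Type) [Field F]
    [CharP F p]
    (h35F : ∀ (n m r : ℕ), 0 < r → r ≤ min n m →
      ∀ f : MvPolynomial (Fin n × Fin m) F, f ∈ detIdeal F n m r → f ≠ 0 →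
      ∃ (c : Matrix (Fin n × Fin m) (Fin n × Fin m) (RatFunc F)) (q : ℤ) (α : F) (σ : Multiset ℕ),
        IsUnit c ∧ α ≠ 0 ∧ r ≤ σ.sup ∧ (∀ s ∈ σ, 0 < s ∧ s ≤ min n m) ∧
        ∀ e : (Fin n × Fin m) →₀ ℕ,
          IsBigOEps F (q + 1) (MvPolynomial.coeff e
            (MvPolynomial.aeval
                (fun ij : Fin n × Fin m =>
                  ∑ kl : Fin n × Fin m, MvPolynomial.C (c ij kl) * MvPolynomial.X kl) f -
              MvPolynomial.C (RatFunc.X ^ q * algebraMap F (RatFunc F) α) *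
                MvPolynomial.map (algebraMap F (RatFunc F)) (kBideterminant F n m σ))))
    (n m r : ℕ) (f : MvPolynomial (Fin n × Fin m) F) (hf : f ∈ detIdeal F n m r) (hf0 : f ≠ 0)
    (hdeg : f.totalDegree < p)
    (h : MvPolynomial (Fin n × Fin m) (LaurentSeries F))
    (hh : PolyOrdGE 1 (h - MvPolynomial.map (algebraMap F (LaurentSeries F)) f))
    (ι : Type) (g : MvPolynomial ι F) (hg : InLayeredABPBorder r g) :
    DepthThreeOracleComputes h (MvPolynomial.map (algebraMap F (LaurentSeries F)) g) := by
  classical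
  obtain ⟨g', hg'abp, hg'g⟩ := hg
  -- `r = 0`: there is no ABP with `0` vertices
  rcases Nat.eq_zero_or_pos r with hr0 | hr0
  · subst hr0; exact absurd hg'abp (not_layeredABPComputes_zero g')
  -- `r > min(n,m)`: the ideal is `⊥`
  by_cases hrnm : r ≤ n ∧ r ≤ m
  swap
  · exfalso; apply hf0
    have := hf
    rwa [detIdeal_eq_bot hrnm, Ideal.mem_bot] at this
  obtain ⟨hrn, hrm⟩ := hrnm
  -- Lemma 3.7 and Lemma 3.6
  obtain ⟨ĝ, D, hĝhom, hĝabp, hĝg'⟩ :=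
    AndrewsForbes2022_lemma_3_7_holds (Polynomial F) ι r g' hg'abp
  obtain ⟨A, hAdeg, hAdet, hAmin⟩ :=
    AndrewsForbes2022_lemma_3_6_holds (Polynomial F) (Option ι) r ĝ hĝabp
  -- the constant case `D = 0`
  rcases Nat.eq_zero_or_pos D with hD0 | hDpos
  · subst hD0
    have hĝC : ĝ = C (coeff 0 ĝ) := by
      by_cases hz : ĝ = 0
      · rw [hz]; simp
      · exact totalDegree_eq_zero_iff_eq_C.mp (hĝhom.totalDegree hz)
    have hg'C : g' = C (coeff 0 ĝ) := by
      rw [← hĝg']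
      conv_lhs => rw [hĝC]
      rw [aeval_C, MvPolynomial.algebraMap_eq]
    have hgC : g = C ((coeff 0 ĝ).coeff 0) := by
      rw [← hg'g, hg'C, map_C, Polynomial.constantCoeff_apply]
    refine ⟨0, fun _ => 0, 0, algebraMap F (RatFunc F) ((coeff 0 ĝ).coeff 0),
      fun _ => by rw [totalDegree_zero]; exact Nat.zero_le _, ?_⟩
    rw [hgC, map_C, map_zero, C_0, zero_mul, zero_add,
      show algebraMap (RatFunc F) (LaurentSeries F) (algebraMap F (RatFunc F) ((coeff 0 ĝ).coeff 0)) =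
        algebraMap F (LaurentSeries F) ((coeff 0 ĝ).coeff 0) from by
          rw [← RingHom.comp_apply, algebraMap_ratFunc_comp_algebraMap], sub_self]
    exact PolyOrdGE.zero 1
  -- Proposition 3.5
  obtain ⟨c, q, α, σ, -, hα, hrσ, hσ, h35⟩ := h35F n m r hr0 (le_min hrn hrm) f hf hf0
  -- the number `t` of parts `≥ r`
  obtain ⟨t, ht⟩ : ∃ t : ℕ, t = Multiset.card (σ.filter fun s => r ≤ s) := ⟨_, rfl⟩
  have htpos : 0 < t := by
    rw [ht, Multiset.card_pos, Ne, Multiset.filter_eq_nil]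
    intro hall
    have : σ.sup ≤ r - 1 := Multiset.sup_le.mpr fun b hb => by
      have := hall b hb; omega
    omega
  -- char `p > deg f ≥ t`: `p ∤ t`, so `k = 0` (p0033:L69–L72); we keep the skeleton with `t = p^0 · t`
  have ht_le : t ≤ f.totalDegree := by
    have h1 : t * r ≤ (σ.filter (r ≤ ·)).sum := by
      rw [ht, ← smul_eq_mul]
      exact Multiset.card_nsmul_le_sum fun x hx => (Multiset.mem_filter.1 hx).2
    have h2 : (σ.filter (r ≤ ·)).sum ≤ σ.sum := by
      conv_rhs => rw [← Multiset.filter_add_not (r ≤ ·) σ]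
      rw [Multiset.sum_add]; exact Nat.le_add_right _ _
    have h3 := sum_le_totalDegree_of_prop35 hα hσ h35
    nlinarith
  obtain ⟨kf, hkf0⟩ : ∃ kf : ℕ, kf = 0 := ⟨0, rfl⟩
  obtain ⟨bf, hbft⟩ : ∃ bf : ℕ, bf = t := ⟨t, rfl⟩
  have hpb : ¬p ∣ bf := by
    rw [hbft]
    exact fun hdvd => absurd (Nat.le_of_dvd htpos hdvd) (not_le.2 (lt_of_le_of_lt ht_le hdeg))
  have htkb : t = p ^ kf * bf := by rw [hkf0, hbft, pow_zero, one_mul]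
  suffices hsuff : DepthThreeOracleComputes h
      (MvPolynomial.map (algebraMap F (LaurentSeries F)) (g ^ p ^ kf)) by
    rw [hkf0, pow_zero, pow_one] at hsuff; exact hsuff
  have hbF : (bf : F) ≠ 0 := by
    rw [Ne, CharP.cast_eq_zero_iff F p]; exact hpb
  obtain ⟨E, hE⟩ : ∃ E : ℕ, E = D * p ^ kf := ⟨_, rfl⟩
  have hEpos : 0 < E := by
    rw [hE]; exact Nat.mul_pos hDpos (Nat.pow_pos (Fact.out : p.Prime).pos)
  obtain ⟨ĝ₂, hĝ₂⟩ : ∃ ĝ₂ : MvPolynomial (Option ι) F[X], ĝ₂ = ĝ ^ p ^ kf := ⟨_, rfl⟩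
  obtain ⟨g₂', hg₂'⟩ : ∃ g₂' : MvPolynomial ι F[X], g₂' = g' ^ p ^ kf := ⟨_, rfl⟩
  have hĝ₂hom : ĝ₂.IsHomogeneous E := by rw [hĝ₂, hE]; exact hĝhom.pow _
  have hĝ₂g' : MvPolynomial.aeval (fun o : Option ι => o.elim 1 X) ĝ₂ = g₂' := by
    rw [hĝ₂, hg₂', map_pow, hĝg']
  have hg₂'g : MvPolynomial.map Polynomial.constantCoeff g₂' = g ^ p ^ kf := by
    rw [hg₂', map_pow, hg'g]
  have hfrob : (1 + ĝ) ^ t = (1 + ĝ₂) ^ bf := by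
    rw [htkb, pow_mul, add_pow_char_pow, one_pow, hĝ₂]
  -- ring homomorphisms: old `ε ↦ ε^{D+1}`
  obtain ⟨φL, hφL⟩ : ∃ φL : F[X] →+* LaurentSeries F,
      φL = (epsPow F E).comp (algebraMap F[X] (LaurentSeries F)) := ⟨_, rfl⟩
  obtain ⟨φK, hφK⟩ : ∃ φK : F[X] →+* RatFunc F,
      φK = (algebraMap F[X] (RatFunc F)).comp
        ((Polynomial.expand F (E + 1) : F[X] →ₐ[F] F[X]) : F[X] →+* F[X]) := ⟨_, rfl⟩
  obtain ⟨ψ, hψ⟩ : ∃ ψ : RatFunc F →+* LaurentSeries F,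
      ψ = (epsPow F E).comp (algebraMap (RatFunc F) (LaurentSeries F)) := ⟨_, rfl⟩
  have hKL : (algebraMap (RatFunc F) (LaurentSeries F)).comp φK = φL := by
    refine RingHom.ext fun p => ?_
    rw [hφK, hφL]
    simp only [RingHom.coe_comp, RingHom.coe_coe, Function.comp_apply]
    rw [← IsScalarTower.algebraMap_apply, algebraMap_expand]
  have hψF : ψ.comp (algebraMap F (RatFunc F)) = algebraMap F (LaurentSeries F) := by
    refine RingHom.ext fun a => ?_
    rw [hψ]
    simp only [RingHom.coe_comp, Function.comp_apply]
    rw [show algebraMap (RatFunc F) (LaurentSeries F) (algebraMap F (RatFunc F) a) =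
      HahnSeries.C a from coe_ratFunc_algebraMap a, epsPow_C, algebraMap_laurentSeries_apply]
  -- the matrices `A` over `F(ε)` and `F((ε))` (old `ε` expanded)
  obtain ⟨AK, hAK⟩ : ∃ AK : Matrix (Fin r) (Fin r) (MvPolynomial (Option ι) (RatFunc F)),
      AK = A.map (MvPolynomial.map φK) := ⟨_, rfl⟩
  obtain ⟨AL, hAL⟩ : ∃ AL : Matrix (Fin r) (Fin r) (MvPolynomial (Option ι) (LaurentSeries F)),
      AL = A.map (MvPolynomial.map φL) := ⟨_, rfl⟩
  have hAKL : AK.map (MvPolynomial.map (algebraMap (RatFunc F) (LaurentSeries F))) = AL := by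
    rw [hAK, hAL, Matrix.map_map]
    congr 1
    funext p
    rw [Function.comp_apply, MvPolynomial.map_map, hKL]
  have hALdet : AL.det = 1 + MvPolynomial.map φL ĝ := by
    rw [hAL, ← RingHom.mapMatrix_apply, ← RingHom.map_det, hAdet, map_add, map_one]
  have hALmin : ∀ (k : ℕ) (hk : k < r),
      (AL.submatrix (Fin.castLE hk.le) (Fin.castLE hk.le)).det = 1 := by
    intro k hk
    rw [hAL, Matrix.submatrix_map, ← RingHom.mapMatrix_apply, ← RingHom.map_det, hAmin k hk,
      map_one]
  -- the substitutions
  obtain ⟨θAK, hθAK⟩ : ∃ θ : Fin n × Fin m → MvPolynomial (Option ι) (RatFunc F),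
      θ = fun kl => extMat AK n m kl.1 kl.2 := ⟨_, rfl⟩
  obtain ⟨θAL, hθAL⟩ : ∃ θ : Fin n × Fin m → MvPolynomial (Option ι) (LaurentSeries F),
      θ = fun kl => extMat AL n m kl.1 kl.2 := ⟨_, rfl⟩
  obtain ⟨θεK, hθεK⟩ : ∃ θ : Option ι → MvPolynomial ι (RatFunc F),
      θ = fun o => C RatFunc.X * o.elim 1 X := ⟨_, rfl⟩
  obtain ⟨θεL, hθεL⟩ : ∃ θ : Option ι → MvPolynomial ι (LaurentSeries F),
      θ = fun o => C (HahnSeries.single 1 1) * o.elim 1 X := ⟨_, rfl⟩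
  obtain ⟨ℓK, hℓK⟩ : ∃ ℓ : Fin n × Fin m → MvPolynomial (Fin n × Fin m) (RatFunc F),
      ℓ = fun ij => ∑ kl, C (ratFuncExpand E (c ij kl)) * X kl := ⟨_, rfl⟩
  obtain ⟨ℓL, hℓL⟩ : ∃ ℓ : Fin n × Fin m → MvPolynomial (Fin n × Fin m) (LaurentSeries F),
      ℓ = fun ij => ∑ kl, C (ψ (c ij kl)) * X kl := ⟨_, rfl⟩
  have hθA : ∀ kl, MvPolynomial.map (algebraMap (RatFunc F) (LaurentSeries F)) (θAK kl) = θAL kl := by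
    intro kl
    rw [hθAK, hθAL]
    show MvPolynomial.map _ (extMat AK n m kl.1 kl.2) = extMat AL n m kl.1 kl.2
    rw [← Matrix.map_apply (f := MvPolynomial.map (algebraMap (RatFunc F) (LaurentSeries F)))
      (M := extMat AK n m), extMat_map, hAKL]
  have hθε : ∀ o, MvPolynomial.map (algebraMap (RatFunc F) (LaurentSeries F)) (θεK o) = θεL o := by
    intro o
    rw [hθεK, hθεL]
    cases o <;> simp [map_X]
  have hℓ : ∀ ij, MvPolynomial.map (algebraMap (RatFunc F) (LaurentSeries F)) (ℓK ij) = ℓL ij := by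
    intro ij
    rw [hℓK, hℓL]
    simp only [map_sum, map_mul, map_C, map_X]
    refine Finset.sum_congr rfl fun kl _ => ?_
    rw [show algebraMap (RatFunc F) (LaurentSeries F) (ratFuncExpand E (c ij kl)) = ψ (c ij kl) from
      by rw [hψ]; exact coe_ratFuncExpand E (c ij kl)]
  -- the circuit data
  obtain ⟨a, ha⟩ : ∃ a : Fin n × Fin m → MvPolynomial ι (RatFunc F),
      a = fun ij => MvPolynomial.bind₁ θεK (MvPolynomial.bind₁ θAK (ℓK ij)) := ⟨_, rfl⟩
  obtain ⟨abar, habar⟩ : ∃ abar : Fin n × Fin m → MvPolynomial ι (LaurentSeries F),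
      abar = fun ij => MvPolynomial.bind₁ θεL (MvPolynomial.bind₁ θAL (ℓL ij)) := ⟨_, rfl⟩
  have haL : ∀ ij, MvPolynomial.map (algebraMap (RatFunc F) (LaurentSeries F)) (a ij) = abar ij := by
    intro ij
    rw [ha, habar]
    simp only [map_bind₁, hθε, hθA, hℓ]
  -- orders of the pole of the bottom gates
  obtain ⟨e, he⟩ := IsOrdGE.exists_neg_nat_forall
    (fun p : (Fin n × Fin m) × (Fin n × Fin m) => ((c p.1 p.2 : RatFunc F) : LaurentSeries F))
  have hθAL0 : ∀ kl, PolyOrdGE 0 (θAL kl) := by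
    intro kl
    rw [hθAL]
    refine polyOrdGE_zero_extMat AL (fun i j => ?_) n m kl.1 kl.2
    rw [hAL, Matrix.map_apply, hφL, ← MvPolynomial.map_map]
    simpa using (polyOrdGE_zero_map_polynomial (A i j)).map_epsPow E
  have hθεL0 : ∀ o, PolyOrdGE 0 (θεL o) := by
    intro o
    have h1 : PolyOrdGE 1 (C (HahnSeries.single 1 (1 : F)) : MvPolynomial ι (LaurentSeries F)) :=
      PolyOrdGE.C (IsOrdGE.single 1 1)
    rw [hθεL]
    cases o with
    | none => simpa using h1.mono (by norm_num)
    | some i => simpa using (h1.mul (PolyOrdGE.X i)).mono (by norm_num)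
  have habar_ord : ∀ ij, PolyOrdGE (-(((E + 1) * e : ℕ) : ℤ)) (abar ij) := by
    intro ij
    rw [habar]
    refine PolyOrdGE.bind₁ (PolyOrdGE.bind₁ ?_ hθAL0) hθεL0
    rw [hℓL]
    refine PolyOrdGE.sum fun kl _ => ?_
    have hc : IsOrdGE (((E : ℤ) + 1) * (-(e : ℤ))) (ψ (c ij kl)) := by
      rw [hψ]; exact (he (ij, kl)).epsPow E
    have := (PolyOrdGE.C (σ := Fin n × Fin m) hc).mul (PolyOrdGE.X kl)
    convert this using 1
    push_cast; ring
  -- degrees of the bottom gates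
  have hadeg : ∀ ij, (a ij).totalDegree ≤ 1 := by
    intro ij
    rw [ha]
    refine (totalDegree_bind₁_le_of_le_one θεK (fun o => ?_) _).trans
      ((totalDegree_bind₁_le_of_le_one θAK (fun kl => ?_) _).trans ?_)
    · rw [hθεK]
      cases o with
      | none => simp [totalDegree_C]
      | some i =>
        refine (totalDegree_mul _ _).trans ?_
        simp [totalDegree_C, totalDegree_X]
    · rw [hθAK]
      refine totalDegree_extMat_le AK (fun i j => ?_) n m kl.1 kl.2
      rw [hAK, Matrix.map_apply]
      exact (totalDegree_map_le' _ _).trans (hAdeg i j)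
    · rw [hℓK]; exact totalDegree_linear_le _
  -- the exponents and the top gate
  obtain ⟨Q, hQ⟩ : ∃ Q : ℤ, Q = ((E : ℤ) + 1) * q := ⟨_, rfl⟩
  obtain ⟨fbar, hfbar⟩ : ∃ fbar : MvPolynomial (Fin n × Fin m) (LaurentSeries F),
      fbar = MvPolynomial.map (algebraMap F (LaurentSeries F)) f := ⟨_, rfl⟩
  obtain ⟨gbar, hgbar⟩ : ∃ gbar : MvPolynomial ι (LaurentSeries F),
      gbar = MvPolynomial.map (algebraMap F (LaurentSeries F)) (g ^ p ^ kf) := ⟨_, rfl⟩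
  obtain ⟨Dh, hDh⟩ : ∃ Dh : ℕ, Dh = (h - fbar).totalDegree := ⟨_, rfl⟩
  obtain ⟨N, hN⟩ : ∃ N : ℕ, N = (Q + E).toNat + (E + 1) * e * Dh := ⟨_, rfl⟩
  obtain ⟨u, hu⟩ : ∃ u : RatFunc F,
      u = (RatFunc.X ^ (Q + E) * algebraMap F (RatFunc F) (α * bf))⁻¹ := ⟨_, rfl⟩
  obtain ⟨v, hv⟩ : ∃ v : RatFunc F,
      v = -(RatFunc.X ^ (E : ℤ) * algebraMap F (RatFunc F) (bf : F))⁻¹ := ⟨_, rfl⟩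
  refine ⟨N, a, u, v, hadeg, ?_⟩
  -- images of `u`, `v` in `F((ε))`
  obtain ⟨w, hw⟩ : ∃ w : LaurentSeries F, w = HahnSeries.single (-(E : ℤ)) ((bf : F)⁻¹) := ⟨_, rfl⟩
  have hcoeX : algebraMap (RatFunc F) (LaurentSeries F) RatFunc.X = HahnSeries.single 1 1 :=
    RatFunc.coe_X
  have hubar : algebraMap (RatFunc F) (LaurentSeries F) u =
      HahnSeries.single (-(Q + E)) ((α * bf : F)⁻¹) := by
    rw [hu, map_inv₀, map_mul, map_zpow₀, hcoeX, ← RatFunc.single_zpow,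
      show algebraMap (RatFunc F) (LaurentSeries F) (algebraMap F (RatFunc F) (α * bf)) =
        HahnSeries.C (α * bf) from coe_ratFunc_algebraMap _, HahnSeries.C_apply,
      HahnSeries.single_mul_single, add_zero, one_mul, HahnSeries.inv_single]
  have hvbar : algebraMap (RatFunc F) (LaurentSeries F) v = -w := by
    rw [hv, map_neg, map_inv₀, map_mul, map_zpow₀, hcoeX, ← RatFunc.single_zpow,
      show algebraMap (RatFunc F) (LaurentSeries F) (algebraMap F (RatFunc F) (bf : F)) =
        HahnSeries.C (bf : F) from coe_ratFunc_algebraMap _, HahnSeries.C_apply,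
      HahnSeries.single_mul_single, add_zero, one_mul, HahnSeries.inv_single, hw]
  -- Step 1: the identity of Prop. 3.5, pushed to `F((ε))` with old `ε` expanded
  obtain ⟨ErrK, hErrK⟩ : ∃ ErrK : MvPolynomial (Fin n × Fin m) (RatFunc F),
      ErrK = MvPolynomial.aeval (fun ij : Fin n × Fin m =>
        ∑ kl : Fin n × Fin m, C (c ij kl) * X kl) f -
      C (RatFunc.X ^ q * algebraMap F (RatFunc F) α) *
        MvPolynomial.map (algebraMap F (RatFunc F)) (kBideterminant F n m σ) := ⟨_, rfl⟩
  have hErr : PolyOrdGE (((E : ℤ) + 1) * (q + 1)) (MvPolynomial.map ψ ErrK) := by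
    intro d
    rw [MvPolynomial.coeff_map, hψ, RingHom.comp_apply]
    have := (isBigOEps_iff_isOrdGE _ _).mp (h35 d)
    rw [← hErrK] at this
    exact this.epsPow E
  have hfℓ : MvPolynomial.map ψ (MvPolynomial.aeval (fun ij : Fin n × Fin m =>
      ∑ kl : Fin n × Fin m, C (c ij kl) * X kl) f) = MvPolynomial.bind₁ ℓL fbar := by
    have hfun : (fun i : Fin n × Fin m => MvPolynomial.map ψ
        (∑ kl : Fin n × Fin m, C (c i kl) * (X kl : MvPolynomial _ (RatFunc F)))) = ℓL := by
      rw [hℓL]; funext ij; simp only [map_sum, map_mul, map_C, map_X]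
    rw [← MvPolynomial.aeval_map_algebraMap (RatFunc F), MvPolynomial.aeval_eq_bind₁, map_bind₁,
      MvPolynomial.map_map, hψF, hfbar, hfun]
  have hKσ : MvPolynomial.map ψ (C (RatFunc.X ^ q * algebraMap F (RatFunc F) α) *
      MvPolynomial.map (algebraMap F (RatFunc F)) (kBideterminant F n m σ)) =
      C (HahnSeries.single Q α) * kBideterminant (LaurentSeries F) n m σ := by
    rw [map_mul, map_C, MvPolynomial.map_map, hψF, map_kBideterminant]
    congr 2
    rw [hψ, RingHom.comp_apply, map_mul, map_zpow₀, hcoeX, ← RatFunc.single_zpow,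
      show algebraMap (RatFunc F) (LaurentSeries F) (algebraMap F (RatFunc F) α) =
        HahnSeries.C α from coe_ratFunc_algebraMap _, map_mul, epsPow_single, epsPow_C,
      HahnSeries.C_apply, HahnSeries.single_mul_single, hQ]
    simp
  have hI1 : MvPolynomial.bind₁ ℓL fbar =
      C (HahnSeries.single Q α) * kBideterminant (LaurentSeries F) n m σ +
        MvPolynomial.map ψ ErrK := by
    rw [← hfℓ, ← hKσ, hErrK, map_sub]; ring
  have hfrobL : (1 + MvPolynomial.map φL ĝ) ^ t = (1 + MvPolynomial.map φL ĝ₂) ^ bf := by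
    have := congrArg (MvPolynomial.map φL) hfrob
    simpa only [map_pow, map_add, map_one] using this
  -- Step 2: substitute `X ↦ A ⊕ I`
  have hI2 : MvPolynomial.bind₁ θAL (MvPolynomial.bind₁ ℓL fbar) =
      C (HahnSeries.single Q α) * (1 + MvPolynomial.map φL ĝ₂) ^ bf +
        MvPolynomial.bind₁ θAL (MvPolynomial.map ψ ErrK) := by
    rw [hI1, map_add, map_mul, bind₁_C_right, hθAL, bind₁_kBideterminant_extMat AL hALmin σ hσ,
      hALdet, ← ht, hfrobL]
  have hE2 : PolyOrdGE (((E : ℤ) + 1) * (q + 1))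
      (MvPolynomial.bind₁ θAL (MvPolynomial.map ψ ErrK)) := hErr.bind₁ hθAL0
  -- Step 3: substitute `y ↦ ε y`, `z ↦ ε`
  obtain ⟨G, hG⟩ : ∃ G : MvPolynomial ι (LaurentSeries F), G = MvPolynomial.map φL g₂' := ⟨_, rfl⟩
  have hGeq : MvPolynomial.bind₁ (fun o : Option ι => o.elim 1 X) (MvPolynomial.map φL ĝ₂) = G := by
    have hfun : (fun o : Option ι => MvPolynomial.map φL (o.elim 1 X)) =
        fun o : Option ι => (o.elim 1 X : MvPolynomial ι (LaurentSeries F)) :=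
      funext fun o => by cases o <;> simp [map_X]
    rw [hG, ← hĝ₂g', MvPolynomial.aeval_eq_bind₁, map_bind₁, hfun]
  have hscale : MvPolynomial.bind₁ θεL (MvPolynomial.map φL ĝ₂) =
      C (HahnSeries.single (E : ℤ) (1 : F)) * G := by
    rw [hθεL, bind₁_C_mul_of_isHomogeneous (hĝ₂hom.map φL) (HahnSeries.single 1 1)
      (fun o : Option ι => o.elim 1 X), hGeq, HahnSeries.single_pow]
    simp
  have habar3 : MvPolynomial.bind₁ abar fbar =
      MvPolynomial.bind₁ θεL (MvPolynomial.bind₁ θAL (MvPolynomial.bind₁ ℓL fbar)) := by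
    rw [habar]; simp only [bind₁_bind₁]
  have hI3 : MvPolynomial.bind₁ abar fbar =
      C (HahnSeries.single Q α) * (1 + C (HahnSeries.single (E : ℤ) (1 : F)) * G) ^ bf +
        MvPolynomial.bind₁ θεL (MvPolynomial.bind₁ θAL (MvPolynomial.map ψ ErrK)) := by
    rw [habar3, hI2, map_add, map_mul, bind₁_C_right, map_pow, map_add, map_one, hscale]
  have hE3 : PolyOrdGE (((E : ℤ) + 1) * (q + 1))
      (MvPolynomial.bind₁ θεL (MvPolynomial.bind₁ θAL (MvPolynomial.map ψ ErrK))) :=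
    hE2.bind₁ hθεL0
  -- Step 4: `G = g + O(ε^{D+1})`, `G = O(1)`
  have hG0 : PolyOrdGE 0 G := by
    rw [hG, hφL, ← MvPolynomial.map_map]
    simpa using (polyOrdGE_zero_map_polynomial g₂').map_epsPow E
  have hE4 : PolyOrdGE ((E : ℤ) + 1) (G - gbar) := by
    have h1 := (polyOrdGE_one_map_polynomial_sub g₂').map_epsPow E
    rw [hg₂'g, map_sub, map_epsPow_map_algebraMap, MvPolynomial.map_map, ← hφL, ← hG, ← hgbar,
      mul_one] at h1
    exact h1
  -- Step 5: binomial expansion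
  obtain ⟨W, hW⟩ := add_pow_eq_remainder (C (HahnSeries.single (E : ℤ) (1 : F)) * G) bf
  have hW0 : PolyOrdGE 0 ((W.map (Nat.castRingHom _)).eval
      (C (HahnSeries.single (E : ℤ) (1 : F)) * G)) :=
    polyOrdGE_zero_eval_natPoly W (((PolyOrdGE.C (IsOrdGE.single _ _)).mul hG0).mono (by omega))
  -- Step 6: the `f`-oracle circuit computes `g + O(ε)`
  have hs1 : HahnSeries.single (-(Q + E)) ((α * bf : F)⁻¹) * HahnSeries.single Q α = w := by
    rw [HahnSeries.single_mul_single, hw]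
    congr 1
    · ring
    · field_simp
  have hs3 : w * (bf : LaurentSeries F) * HahnSeries.single (E : ℤ) (1 : F) = 1 := by
    rw [hw, ← map_natCast (HahnSeries.C : F →+* LaurentSeries F) bf, HahnSeries.C_apply,
      HahnSeries.single_mul_single, HahnSeries.single_mul_single, ← HahnSeries.single_zero_one]
    congr 1
    · ring
    · field_simp
  have hmain : PolyOrdGE 1
      (C (algebraMap (RatFunc F) (LaurentSeries F) u) * MvPolynomial.bind₁ abar fbar +
        C (algebraMap (RatFunc F) (LaurentSeries F) v) - gbar) := by
    rw [hubar, hvbar, hI3, hW]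
    have key : C (HahnSeries.single (-(Q + E)) ((α * bf : F)⁻¹)) *
        (C (HahnSeries.single Q α) * (1 + (bf : MvPolynomial ι (LaurentSeries F)) *
          (C (HahnSeries.single (E : ℤ) (1 : F)) * G) +
          (C (HahnSeries.single (E : ℤ) (1 : F)) * G) ^ 2 *
            (W.map (Nat.castRingHom _)).eval (C (HahnSeries.single (E : ℤ) (1 : F)) * G)) +
          MvPolynomial.bind₁ θεL (MvPolynomial.bind₁ θAL (MvPolynomial.map ψ ErrK))) +
        C (-w) - gbar =
      (C (HahnSeries.single (-(Q + E)) ((α * bf : F)⁻¹) * HahnSeries.single Q α) - C w) +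
      ((C (HahnSeries.single (-(Q + E)) ((α * bf : F)⁻¹) * HahnSeries.single Q α *
          (bf : LaurentSeries F) * HahnSeries.single (E : ℤ) (1 : F)) - 1) * gbar +
        C (HahnSeries.single (-(Q + E)) ((α * bf : F)⁻¹) * HahnSeries.single Q α *
          (bf : LaurentSeries F) * HahnSeries.single (E : ℤ) (1 : F)) * (G - gbar)) +
      C (HahnSeries.single (-(Q + E)) ((α * bf : F)⁻¹) * HahnSeries.single Q α *
          HahnSeries.single (E : ℤ) (1 : F) ^ 2) *
        (G ^ 2 * (W.map (Nat.castRingHom _)).eval (C (HahnSeries.single (E : ℤ) (1 : F)) * G)) +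
      C (HahnSeries.single (-(Q + E)) ((α * bf : F)⁻¹)) *
        MvPolynomial.bind₁ θεL (MvPolynomial.bind₁ θAL (MvPolynomial.map ψ ErrK)) := by
      simp only [map_mul, map_neg, map_pow,
        ← map_natCast (C : LaurentSeries F →+* MvPolynomial ι (LaurentSeries F)) bf]
      ring
    rw [key]
    refine ((PolyOrdGE.add ?_ ?_).add ?_).add ?_
    · rw [hs1, sub_self]; exact PolyOrdGE.zero 1
    · rw [hs1, hs3, C_1, sub_self, zero_mul, zero_add, one_mul]
      exact hE4.mono (by omega)
    · have hord : IsOrdGE (E : ℤ) (HahnSeries.single (-(Q + E)) ((α * bf : F)⁻¹) *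
          HahnSeries.single Q α * HahnSeries.single (E : ℤ) (1 : F) ^ 2) := by
        rw [hs1, hw, sq, HahnSeries.single_mul_single, HahnSeries.single_mul_single]
        convert IsOrdGE.single (F := F) _ _ using 2; ring
      have := (PolyOrdGE.C hord).mul ((hG0.pow 2).mul hW0)
      exact this.mono (by simp only [add_zero]; exact_mod_cast hEpos)
    · have hord : IsOrdGE (-(Q + E)) (HahnSeries.single (-(Q + E)) ((α * bf : F)⁻¹)) :=
        IsOrdGE.single _ _
      have := (PolyOrdGE.C hord).mul hE3
      have heq : -(Q + (E : ℤ)) + ((E : ℤ) + 1) * (q + 1) = 1 := by rw [hQ]; ring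
      exact this.mono heq.symm.le
  -- Step 7: replace the `f`-oracle by the `h(·, ε^{N+1})`-oracle
  have hdiff : PolyOrdGE 1 (C (algebraMap (RatFunc F) (LaurentSeries F) u) *
      MvPolynomial.bind₁ abar (MvPolynomial.map (epsPow F N) h - fbar)) := by
    have hsub : MvPolynomial.map (epsPow F N) h - fbar = MvPolynomial.map (epsPow F N) (h - fbar) := by
      rw [map_sub, hfbar, map_epsPow_map_algebraMap]
    have h1 : PolyOrdGE (((N : ℤ) + 1) * 1) (MvPolynomial.map (epsPow F N) (h - fbar)) :=
      (hfbar ▸ hh).map_epsPow N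
    have hdeg : (MvPolynomial.map (epsPow F N) (h - fbar)).totalDegree ≤ Dh := by
      rw [hDh]; exact totalDegree_map_le' _ _
    have h2 := h1.bind₁_of_totalDegree_le hdeg habar_ord
    have hord : IsOrdGE (-(Q + E)) (algebraMap (RatFunc F) (LaurentSeries F) u) := by
      rw [hubar]; exact IsOrdGE.single _ _
    rw [hsub]
    refine ((PolyOrdGE.C hord).mul h2).mono ?_
    have : Q + (E : ℤ) ≤ ((Q + E).toNat : ℤ) := Int.self_le_toNat _
    rw [hN]; push_cast; nlinarith
  -- conclusion
  have hfin := hmain.add hdiff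
  have hfun : (fun x => MvPolynomial.map (algebraMap (RatFunc F) (LaurentSeries F)) (a x)) = abar :=
    funext haL
  rw [MvPolynomial.aeval_eq_bind₁, hfun, ← hgbar]
  have heq : C (algebraMap (RatFunc F) (LaurentSeries F) u) *
        MvPolynomial.bind₁ abar (MvPolynomial.map (epsPow F N) h) +
      C (algebraMap (RatFunc F) (LaurentSeries F) v) - gbar =
      C (algebraMap (RatFunc F) (LaurentSeries F) u) * MvPolynomial.bind₁ abar fbar +
        C (algebraMap (RatFunc F) (LaurentSeries F) v) - gbar +
      C (algebraMap (RatFunc F) (LaurentSeries F) u) *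
        MvPolynomial.bind₁ abar (MvPolynomial.map (epsPow F N) h - fbar) := by
    rw [map_sub]; ring
  rw [heq]
  exact hfin


/-! ### Corollary 3.10 (third bullet, `k = 0`) and the discharge of Lemma 6.6 -/

/-- **Corollary 3.10, third bullet, with `k = 0` when `char F = p > deg f`** (p0024:L76 with
p0033:L69–L72): for nonzero `f ∈ I^det_{n,m,r}` with `deg f < p = char F`, `h = f + O(ε)` and
`w(d-1)+2 ≤ r`, a depth-three `h`-oracle circuit computes `IMM_{w,d}(y) + O(ε)` itself (no `p`-th
power).  From `AndrewsForbes2022_thm_3_8_posChar_deg_lt`, Prop. 3.5 over every field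
(`AndrewsForbes2022_prop_3_5_of_field`) and the layered ABP for `IMM_{w,d}`
(`layeredABPComputes_imm11Poly`). [cite: AndrewsForbes2022, Cor. 3.10 (third bullet) and Lemma 6.6 (proof)] -/
theorem AndrewsForbes2022_cor_3_10_posChar_deg_lt (p : ℕ) [Fact p.Prime] (F : Type) [Field F]
    [CharP F p] (n m r : ℕ) (f : MvPolynomial (Fin n × Fin m) F) (hf : f ∈ detIdeal F n m r)
    (hf0 : f ≠ 0) (hdeg : f.totalDegree < p) (h : MvPolynomial (Fin n × Fin m) (LaurentSeries F))
    (hh : PolyOrdGE 1 (h - MvPolynomial.map (algebraMap F (LaurentSeries F)) f))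
    (w d : ℕ) [NeZero w] (hwd : w * (d - 1) + 2 ≤ r) :
    DepthThreeOracleComputes h
      (MvPolynomial.map (algebraMap F (LaurentSeries F)) (imm11Poly w d F)) :=
  AndrewsForbes2022_thm_3_8_posChar_deg_lt p F
    (fun n m r hr _ f hf hf0 => AndrewsForbes2022_prop_3_5_of_field F n m r hr f hf hf0)
    n m r f hf hf0 hdeg h hh _ _
    (InLayeredABPBorder.of_computes ((layeredABPComputes_imm11Poly (F := F) w d).mono hwd))

/-- **Discharge of `AndrewsForbes2022_lemma_6_6`** (AF22 Lemma 6.6, p0033:L33, for EVERY field under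
its printed hypothesis `char F = 0 ∨ char F > deg f`), with the universal constant `c = log 56`:
the engine `AndrewsForbes2022_lemma_6_6_core` fed with Cor. 3.10 — `AndrewsForbes2022_cor_3_10_holds`
in characteristic `0`, `AndrewsForbes2022_cor_3_10_posChar_deg_lt` in characteristic `p > deg f` —
and `char F > deg f ≥ r` (`Theorem38.le_totalDegree_of_mem_detIdeal`).
[cite: AndrewsForbes2022, Lemma 6.6] -/
theorem AndrewsForbes2022_lemma_6_6_holds : AndrewsForbes2022_lemma_6_6 := by
  obtain ⟨-, -, H⟩ := AndrewsForbes2022_lemma_6_6_core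
  refine ⟨Real.log 56, Real.log_pos (by norm_num), fun Δ hΔ => ?_⟩
  obtain ⟨r₀, hr₀⟩ := H Δ hΔ
  refine ⟨r₀, fun F _ n m r hr f hf hf0 hchar s hs => hr₀ F (Fin n × Fin m) r hr ?_ f ?_ s hs⟩
  · rcases hchar with h0 | hp
    · exact Or.inl h0
    · exact Or.inr (lt_of_le_of_lt (Theorem38.le_totalDegree_of_mem_detIdeal hf hf0) hp)
  · intro h hh w d _ hwd
    rcases hchar with h0 | hp
    · haveI : CharZero F := (CharP.ringChar_zero_iff_CharZero F).1 h0
      exact AndrewsForbes2022_cor_3_10_holds F n m r f hf hf0 h hh w d hwd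
    · have hne : ringChar F ≠ 0 := by omega
      haveI : Fact (ringChar F).Prime := ⟨CharP.char_prime_of_ne_zero F hne⟩
      exact AndrewsForbes2022_cor_3_10_posChar_deg_lt (ringChar F) F n m r f hf hf0 hp h hh w d hwd

end Literature.Computability.AlgebraicComplexity
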